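/-
Copyright (c) 2026 the pub-hodgecm-mathlib formalisation cell (harness21).  Prover seat hodgecm-mathlib-K2E1-p15 (g3), Track B ∕ K2-LIT, h413 = `stmt-HodgeConjecture-24833`,
R90-TF section S8 «ContSpec-n½», the (V) road of B's MID socket (★ p863385 `resGMidBlock_ne_bot_assembly`, row (i)), deals S8-R162 (2) ∕ S8-R171 (2): the `χ`-Eisenstein EXPORTS AT
THE WITNESS PAIR BLOCK — ★ row 8 LEVEL print WITH BOUND at the untwisted block `(χ, 1)`, transported to the pair block `(χ·ψ̃⁻¹, ψ)` by the ★ PAIR DET-TWIST `Θ = ψ∘det`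
(census `R90/S8/CENSUS-ChiPairExportsOfWitness.K2E1-p15-g3.md`).
-/
import Summits.HodgeConjecture.HodgeConjecture.Theorems.K2E1ChiEisensteinMeromorphicExportsWithBoundCMThree   -- ★ p863590 (this seat): row 8 LEVEL print + (E2-bd)
import Summits.HodgeConjecture.HodgeConjecture.Theorems.K2E1ChiEisensteinDetTwistU3                         -- ★ p863567 (R90-C133-p02): PAIR DET-TWIST FILE B (+ FILE A ★ p863514, ★ U2 generic twist lemmas)
import HarnessLib

/-!
# S8 (V)(i) — `R90S8ChiPairExportsOfWitnessU3`: the continued Eisenstein family of the S8 PAIR block `(χ·ψ̃⁻¹, ψ)` — ★ row 8 exports at `(χ, 1)` twisted by `Θ = ψ∘det` — with its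
# scattering coordinates, pole set, tube identity, holomorphy, (E4) and (E2-bd)

Track B ∕ K2-LIT, crux h413 = `stmt-HodgeConjecture-24833`, route of record `HCCMUnconditional`; cell `hodgecm-mathlib`, R90-TF programme, section S8 «ContSpec-n½», socket B MID ∕ (V)
road (★ p863385, row (i) `K′ ω φ hφ hφc Ec Sp hSp hEd hE2 Fp hF hFE hE4 hEbd`).  THEOREMS ONLY (no `def`, no `instance`, no `notation`, no named-fact hypothesis, no `sorry`;
default heartbeats); lane `--supports stmt-HodgeConjecture-24833 --as helper` (count-neutral).  CLOSES NO SOCKET.  At the witness the pair block is `(ξ.bcη⁻¹·ξ.bcψ⁻¹·μω, ξ.ψ)` =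
the `ξ.ψ∘det`-twist of the single-character block `(ξ.bcη⁻¹·μω, 1)`; this file is stated for a GENERAL `χ` and automorphic `ψ` (consumer: `χ := ξ.bcη⁻¹ * μω`, `ψ := ξ.ψ`, and
`pullback ξ.ψ = ξ.bcψ` from the ★ S8 frame).  ROAD (census): ★ `chiEisenstein_meromorphic_exports_level_cm_three_with_bound` (row 8 + (E2-bd), χ₂ = 1, level `K′ ∋ ι(K_∞)`,
`U₀`-trivial `ω`) gives `(q, Ec, qc, P)`; scalars `q qc` and the pole set `P` do not twist; the block data twist by ★ FILE A `mul_detChar_mem_chiSectionSpacePair` (membership in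
`V(χ·ψ̃⁻¹, ψ; K′, ω·Θ)`), ★ `eisensteinSeriesU_flatSectionU_mul_automorphicCharacter` (tube identity `E((φΘ)_z) = E(φ_z)·Θ`), ★ `differentiableOn_twist` ∕ `continuous_twist` ∕
`locally_bounded_twist` (`|Θ| = 1`).
* §1 **`chiPair_exports_of_witness`** — `∃ q Ec qc P`: untwisted rows `hq hqφ hE2 hqcq`, `IsClosed P`, `hPcd`, `hPre`, `hqa`; twisted rows: membership, continuity, tube identity for `Ec·Θ`,
  analyticity ∕ holomorphy of `z ↦ Ec z g·Θ g` off `P`, (E4) and (E2-bd) for `Ec·Θ` off `P`.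
* §2 **`chiPair_rowsEdE4Ebd_of_poleLedger`** — the three rows `hEd hE4 hEbd` of ★ p863385 in its BYTES (domain `{1<Re} ∖ Sp`) for ANY family, from the `Pᶜ`-rows and the pole-ledger
  inclusion `{1<Re} ∖ Sp ⊆ Pᶜ`.
STAYS A LETTER (census): `Sp hSp` + the inclusion, the pole letter `Fp hF hFE` at `3∕2` (pole ledger, K2E2-p12), the scalar road `hfac ψ φt qc` (ℓ-CT).
HONEST LABEL: HC_CM is proved only modulo the 7 printed citations (2 remaining named inputs: hLiu418 = `stmt-HodgeConjecture-24832`, h413 = `stmt-HodgeConjecture-24833`) until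
rung 0 closes; REL ≠ ★ ≠ BUILT; this file instantiates ★ exports and ★ transports and pays no letter by itself; count-neutral.

## References
* [BernsteinLapid2019] J. Bernstein, E. Lapid, *On the meromorphic continuation of Eisenstein series*, J. Amer. Math. Soc. 37 (2024), Thm 2.3, §4, §7.
* [MoeglinWaldspurger1995] C. Mœglin, J.-L. Waldspurger, *Spectral Decomposition and Eisenstein Series* (1995), II.1.5, II.1.7, IV.1.8–IV.1.11.
* [Rogawski1990] J. D. Rogawski, *Automorphic Representations of Unitary Groups in Three Variables* (1990), §13.3 p. 202.
-/

set_option autoImplicit false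
set_option linter.dupNamespace false  -- the mandated namespace `…HodgeConjecture.HodgeConjecture.R90.S8` (LEAD #1 L1) repeats the summit's segment

noncomputable section

open MeasureTheory Measure Filter Topology Set NumberField IsDedekindDomain
open scoped NNReal ENNReal MatrixGroups
open Literature.MeasureTheory.Group Literature.NumberTheory Literature.NumberTheory.Automorphic Literature.NumberTheory.Automorphic.UnitaryGroup AdelicGroupData
open Literature.NumberTheory.Automorphic.Arthur2013.Leaves.TECR
open Literature.NumberTheory.GaloisRepresentations (HeckeCharacter)
open Summit.HodgeConjecture.HodgeConjecture.Cruxes.H413.K2E1BorelEisensteinU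
open Summit.HodgeConjecture.HodgeConjecture.Cruxes.H413.K2E1BLBorelSpacesU2Defs
open Summit.HodgeConjecture.HodgeConjecture.Cruxes.H413.K2E1BLBorelOperatorsU2Defs
open Summit.HodgeConjecture.HodgeConjecture.Cruxes.H413.K2E1CharacterEisensteinU2Defs
open Summit.HodgeConjecture.HodgeConjecture.Cruxes.H413.K2E1ChiSectionSpaceU2Defs
open Summit.HodgeConjecture.HodgeConjecture.Cruxes.H413.K2E1CharacterEisensteinU3PairDefs
open Summit.HodgeConjecture.HodgeConjecture.Cruxes.H413.K2E1ChiSectionSpaceU3PairDefs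
open Summit.HodgeConjecture.HodgeConjecture.Cruxes.H413.K2E1ChiEisensteinMeromorphicExportsWithBoundCMThree (chiEisenstein_meromorphic_exports_level_cm_three_with_bound)
open Summit.HodgeConjecture.HodgeConjecture.Cruxes.H413.K2E1ChiDetCharBorelU3 (mul_detChar_mem_chiSectionSpacePair)
open Summit.HodgeConjecture.HodgeConjecture.Cruxes.H413.K2E1ChiEisensteinDetTwistU2 (eisensteinSeriesU_flatSectionU_mul_automorphicCharacter differentiableOn_twist continuous_twist locally_bounded_twist)

namespace Summit.HodgeConjecture.HodgeConjecture.R90.S8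

variable (L : Type) [Field L] [NumberField L] [IsCMField L]
  [MeasurableSpace (quasiSplit (↥(maximalRealSubfield L)) L (IsCMField.complexConj L) 3).Adelic] [BorelSpace (quasiSplit (↥(maximalRealSubfield L)) L (IsCMField.complexConj L) 3).Adelic]
  [MeasurableSpace (arch (↥(maximalRealSubfield L)) L (IsCMField.complexConj L) 3 ((StdForm.antidiagonal 3).over L))] [BorelSpace (arch (↥(maximalRealSubfield L)) L (IsCMField.complexConj L) 3 ((StdForm.antidiagonal 3).over L))]
  [MeasurableSpace (finAdelic (↥(maximalRealSubfield L)) L (IsCMField.complexConj L) 3 ((StdForm.antidiagonal 3).over L))] [BorelSpace (finAdelic (↥(maximalRealSubfield L)) L (IsCMField.complexConj L) 3 ((StdForm.antidiagonal 3).over L))]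

/-! ## §1 The exports at the witness pair block -/

/-- **THE `χ`-EISENSTEIN EXPORTS AT THE PAIR BLOCK `(χ·ψ̃⁻¹, ψ)`** (★ row 8 LEVEL print WITH BOUND at `(χ, 1)` ∘ ★ PAIR DET-TWIST `Θ = detChar ψ`): for a continuous bounded `φ ∈ V(χ, K′, ω)` at a
level `K′ ∋ ι(K_∞)`, `K′ ≤ K`, with `ω` trivial on an open compact `U₀`-part, continuous sections and a continuous bounded basis of `V(χʷ, K′, ω)`, and an automorphic `ψ` of
`U(1)(𝔸_{L⁺})`: there are scattering coordinates `q_j` (holomorphic on `{2 < Re}`, `hqφ`), their continuations `qc_j`, the continued family `Ec` and ONE closed co-discrete pole set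
`P ⊆ {Re ≤ 2}` such that, for the TWISTED section `φΘ ∈ V(χ·ψ̃⁻¹, ψ; K′, ω·Θ)` (continuous), `Ec·Θ` continues `z ↦ E((φΘ)_z)` (tube identity on `{2 < Re}`), is holomorphic in `z` off `P`
for every `g`, continuous in `g` off `P` (E4), and LOCALLY JOINTLY BOUNDED off `P` (E2-bd).
[cite: BernsteinLapid2019, Thm 2.3, §4, §7] [cite: MoeglinWaldspurger1995, II.1.5, IV.1.8–IV.1.11] [cite: Rogawski1990, §13.3 p. 202] -/
theorem chiPair_exports_of_witness
    (μ : Measure (quasiSplit (↥(maximalRealSubfield L)) L (IsCMField.complexConj L) 3).automorphicQuotient) [(quasiSplit (↥(maximalRealSubfield L)) L (IsCMField.complexConj L) 3).IsAutomorphicMeasure μ]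
    (νG : Measure (quasiSplit (↥(maximalRealSubfield L)) L (IsCMField.complexConj L) 3).Adelic) [νG.IsHaarMeasure] [νG.IsInvInvariant] [SFinite νG]
    (ν : Measure ↥(adelicUnipotent (↥(maximalRealSubfield L)) L (IsCMField.complexConj L) 3)) [ν.IsHaarMeasure] [ν.IsMulRightInvariant] [ν.IsInvInvariant]
    {𝓕 : Set ↥(adelicUnipotent (↥(maximalRealSubfield L)) L (IsCMField.complexConj L) 3)}
    (h𝓕N : IsFundamentalDomain ↥(rationalUnipotent (↥(maximalRealSubfield L)) L (IsCMField.complexConj L) 3) 𝓕 ν) (h𝓕c : IsCompact (closure 𝓕)) (h𝓕₀ : ν 𝓕 ≠ 0)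
    {β : (quasiSplit (↥(maximalRealSubfield L)) L (IsCMField.complexConj L) 3).Adelic → ℝ≥0∞}
    (hβ : IsCoveringWeight ↥((arithmeticBorel (↥(maximalRealSubfield L)) L (IsCMField.complexConj L) 3).map (quasiSplit (↥(maximalRealSubfield L)) L (IsCMField.complexConj L) 3).arithmeticSubgroup.subtype) β)
    {μZ : Measure (borelQuotient (↥(maximalRealSubfield L)) L (IsCMField.complexConj L) 3)} [SFinite μZ]
    (hμZ : ∀ f : borelQuotient (↥(maximalRealSubfield L)) L (IsCMField.complexConj L) 3 → ℝ≥0∞, Measurable f → ∫⁻ z, f z ∂μZ = ∫⁻ g, β g * f (toBorelQuotient (↥(maximalRealSubfield L)) L (IsCMField.complexConj L) 3 g) ∂νG)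
    -- the M1 family: `φ ∈ V(χ, K, 1)` continuous bounded with `φ ∘ ι_∞ = φ(1)`, and a basis of `V(χʷ, K, 1)` by continuous bounded functions
    {χ : HeckeCharacter L} {K' : Subgroup (quasiSplit (↥(maximalRealSubfield L)) L (IsCMField.complexConj L) 3).Adelic} {ω : ↥K' → ℂ} {φ : (quasiSplit (↥(maximalRealSubfield L)) L (IsCMField.complexConj L) 3).Adelic → ℂ} (hφV : φ ∈ chiSectionSpace χ K' ω) (hφc : Continuous φ) {Mφ : ℝ} (hφM : ∀ x, ‖φ x‖ ≤ Mφ)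
    -- the LEVEL: `K′ ≤ K`, `ι(K_∞) ⊆ K′`, an open compact `U₀` with `ι_f(U₀ ∩ G_f) ⊆ K′` on which `ω = 1`, continuity of the sections; auxiliary Haar measures on `G_∞` (two-sided) and `G(𝔸_f)`
    (hK' : K' ≤ ((standardMaximalCompactGL 3 L).comap (adelicVal (↥(maximalRealSubfield L)) L (IsCMField.complexConj L) 3 ((StdForm.antidiagonal 3).over L)) : Subgroup (quasiSplit (↥(maximalRealSubfield L)) L (IsCMField.complexConj L) 3).Adelic))
    (hKinf : ∀ k : arch (↥(maximalRealSubfield L)) L (IsCMField.complexConj L) 3 ((StdForm.antidiagonal 3).over L), adelicVal (↥(maximalRealSubfield L)) L (IsCMField.complexConj L) 3 ((StdForm.antidiagonal 3).over L) (archToAdelic (↥(maximalRealSubfield L)) L (IsCMField.complexConj L) 3 _ k) ∈ standardMaximalCompactGL 3 L →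
      archToAdelic (↥(maximalRealSubfield L)) L (IsCMField.complexConj L) 3 _ k ∈ K')
    (U₀ : Subgroup (GL (Fin 3) (FiniteAdeleRing (𝓞 L) L))) (hU₀o : IsOpen (U₀ : Set (GL (Fin 3) (FiniteAdeleRing (𝓞 L) L)))) (hU₀c : IsCompact (U₀ : Set (GL (Fin 3) (FiniteAdeleRing (𝓞 L) L))))
    (hU : ∀ b : finAdelic (↥(maximalRealSubfield L)) L (IsCMField.complexConj L) 3 ((StdForm.antidiagonal 3).over L), (b : GL (Fin 3) (FiniteAdeleRing (𝓞 L) L)) ∈ U₀ →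
      ∃ hb : finAdelicToAdelic (↥(maximalRealSubfield L)) L (IsCMField.complexConj L) 3 ((StdForm.antidiagonal 3).over L) b ∈ K', ω ⟨_, hb⟩ = 1)
    (hVc : ∀ φ ∈ chiSectionSpace χ K' ω, Continuous φ)
    (μa : Measure (arch (↥(maximalRealSubfield L)) L (IsCMField.complexConj L) 3 ((StdForm.antidiagonal 3).over L))) [μa.IsHaarMeasure] [μa.IsMulRightInvariant]
    (μf : Measure (finAdelic (↥(maximalRealSubfield L)) L (IsCMField.complexConj L) 3 ((StdForm.antidiagonal 3).over L))) [μf.IsHaarMeasure]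
    {ι' : Type} [Fintype ι'] [DecidableEq ι'] (bV : Module.Basis ι' ℂ ↥(chiSectionSpace (reflectChar (IsCMField.complexConj L) χ) K' ω))
    (hbc : ∀ j, Continuous ((bV j : ↥(chiSectionSpace (reflectChar (IsCMField.complexConj L) χ) K' ω)) : (quasiSplit (↥(maximalRealSubfield L)) L (IsCMField.complexConj L) 3).Adelic → ℂ)) {Mb : ℝ} (hbM : ∀ j x, ‖((bV j : ↥(chiSectionSpace (reflectChar (IsCMField.complexConj L) χ) K' ω)) : (quasiSplit (↥(maximalRealSubfield L)) L (IsCMField.complexConj L) 3).Adelic → ℂ) x‖ ≤ Mb)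
    (h2 : Module.finrank (↥(maximalRealSubfield L)) L = 2) (hc : IsCMField.complexConj L ≠ 1) (hJ : ((StdForm.antidiagonal 3).over L).det ≠ 0)
    (ψ : ↥(TorusDict.torus (IsCMField.complexConj L)) →ₜ* ℂˣ) (hψ : TorusDict.IsAutomorphic (IsCMField.complexConj L) ψ) :
    ∃ (q : ι' → ℂ → ℂ) (Ec : ℂ → (quasiSplit (↥(maximalRealSubfield L)) L (IsCMField.complexConj L) 3).Adelic → ℂ) (qc : ι' → ℂ → ℂ) (P : Set ℂ),
      -- the untwisted scalar rows and the pole set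
      (∀ j, DifferentiableOn ℂ (q j) {z : ℂ | 2 < z.re}) ∧
      (∀ z : ℂ, 2 < z.re → (∑ j, q j z • ((bV j : ↥(chiSectionSpace (reflectChar (IsCMField.complexConj L) χ) K' ω)) : (quasiSplit (↥(maximalRealSubfield L)) L (IsCMField.complexConj L) 3).Adelic → ℂ)) = ((((ν 𝓕).toReal⁻¹ : ℝ)) : ℂ) • (fun g : (quasiSplit (↥(maximalRealSubfield L)) L (IsCMField.complexConj L) 3).Adelic => (∫ v : ↥(adelicUnipotent (↥(maximalRealSubfield L)) L (IsCMField.complexConj L) 3), flatSectionU φ z ((quasiSplit (↥(maximalRealSubfield L)) L (IsCMField.complexConj L) 3).toAdelic (weylLongU ((IsCMField.complexConj L : L ≃ₐ[↥(maximalRealSubfield L)] L) : L →+* L) (rfl : (StdForm.antidiagonal 3).over L = (StdForm.antidiagonal 3).over L)) * ((v : (quasiSplit (↥(maximalRealSubfield L)) L (IsCMField.complexConj L) 3).Adelic) * g)) ∂ν) * (((borelHeight g : ℝ) : ℂ) ^ (z - 2)))) ∧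
      (∀ z : ℂ, 2 < z.re → Ec z = eisensteinSeriesU (flatSectionU φ z)) ∧ (∀ j (z : ℂ), 2 < z.re → qc j z = q j z) ∧
      IsClosed P ∧ (∀ z₀ : ℂ, ∀ᶠ s in 𝓝[≠] z₀, s ∉ P) ∧ (∀ z ∈ P, z.re ≤ 2) ∧ (∀ j (z : ℂ), z ∉ P → AnalyticAt ℂ (qc j) z) ∧
      -- the twisted pair block `(χ·ψ̃⁻¹, ψ)`: section, tube identity, holomorphy, (E4), (E2-bd) for `Ec·Θ`
      (fun x => φ x * ((detChar (↥(maximalRealSubfield L)) L (IsCMField.complexConj L) h2 hc 3 ((StdForm.antidiagonal 3).over L) ψ hψ hJ x : ℂˣ) : ℂ)) ∈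
        chiSectionSpacePair (χ * (TorusDict.pullback (IsCMField.complexConj L) h2 hc ψ hψ)⁻¹) ((1 : ↥(TorusDict.torus (IsCMField.complexConj L)) →ₜ* ℂˣ) * ψ) K'
          (fun k => ω k * ((detChar (↥(maximalRealSubfield L)) L (IsCMField.complexConj L) h2 hc 3 ((StdForm.antidiagonal 3).over L) ψ hψ hJ (k : (quasiSplit (↥(maximalRealSubfield L)) L (IsCMField.complexConj L) 3).Adelic) : ℂˣ) : ℂ)) ∧
      Continuous (fun x => φ x * ((detChar (↥(maximalRealSubfield L)) L (IsCMField.complexConj L) h2 hc 3 ((StdForm.antidiagonal 3).over L) ψ hψ hJ x : ℂˣ) : ℂ)) ∧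
      (∀ z : ℂ, 2 < z.re → (fun x => Ec z x * ((detChar (↥(maximalRealSubfield L)) L (IsCMField.complexConj L) h2 hc 3 ((StdForm.antidiagonal 3).over L) ψ hψ hJ x : ℂˣ) : ℂ)) = eisensteinSeriesU (flatSectionU (fun x => φ x * ((detChar (↥(maximalRealSubfield L)) L (IsCMField.complexConj L) h2 hc 3 ((StdForm.antidiagonal 3).over L) ψ hψ hJ x : ℂˣ) : ℂ)) z)) ∧
      (∀ g (z : ℂ), z ∉ P → AnalyticAt ℂ (fun z => Ec z g * ((detChar (↥(maximalRealSubfield L)) L (IsCMField.complexConj L) h2 hc 3 ((StdForm.antidiagonal 3).over L) ψ hψ hJ g : ℂˣ) : ℂ)) z) ∧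
      (∀ g, DifferentiableOn ℂ (fun z => Ec z g * ((detChar (↥(maximalRealSubfield L)) L (IsCMField.complexConj L) h2 hc 3 ((StdForm.antidiagonal 3).over L) ψ hψ hJ g : ℂˣ) : ℂ)) Pᶜ) ∧
      (∀ z : ℂ, z ∉ P → Continuous (fun x => Ec z x * ((detChar (↥(maximalRealSubfield L)) L (IsCMField.complexConj L) h2 hc 3 ((StdForm.antidiagonal 3).over L) ψ hψ hJ x : ℂˣ) : ℂ))) ∧
      (∀ z₁ : ℂ, z₁ ∉ P → ∀ K : Set (quasiSplit (↥(maximalRealSubfield L)) L (IsCMField.complexConj L) 3).Adelic, IsCompact K → ∃ V ∈ 𝓝 z₁, ∃ M : ℝ, ∀ z ∈ V, ∀ g ∈ K, ‖Ec z g * ((detChar (↥(maximalRealSubfield L)) L (IsCMField.complexConj L) h2 hc 3 ((StdForm.antidiagonal 3).over L) ψ hψ hJ g : ℂˣ) : ℂ)‖ ≤ M) := by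
  obtain ⟨q, Ec, qc, P, hq, hqφ, -, -, hE2, hqcq, hPc, hPcd, hPre, hEan, hqan, hEdiff, -, hE4, hEbd⟩ :=
    chiEisenstein_meromorphic_exports_level_cm_three_with_bound L μ νG ν h𝓕N h𝓕c h𝓕₀ hβ hμZ hφV hφc hφM hK' hKinf U₀ hU₀o hU₀c hU hVc μa μf bV hbc hbM
  -- the untwisted section in the pair currency at `χ₂ = 1`
  have hφ1 : φ ∈ chiSectionSpacePair χ (1 : ↥(TorusDict.torus (IsCMField.complexConj L)) →ₜ* ℂˣ) K' ω := by
    rw [chiSectionSpacePair_one]; exact hφV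
  refine ⟨q, Ec, qc, P, hq, hqφ, hE2, hqcq, hPc, hPcd, hPre, hqan,
    mul_detChar_mem_chiSectionSpacePair h2 hc hJ ψ hψ hφ1,
    hφc.mul (detChar (↥(maximalRealSubfield L)) L (IsCMField.complexConj L) h2 hc 3 ((StdForm.antidiagonal 3).over L) ψ hψ hJ).continuous,
    fun z hz => ?_, fun g z hz => (hEan g z hz).mul analyticAt_const,
    differentiableOn_twist Ec hEdiff _,
    fun z hz => continuous_twist Ec (D := Pᶜ) (fun z hz => hE4 z hz) (detChar (↥(maximalRealSubfield L)) L (IsCMField.complexConj L) h2 hc 3 ((StdForm.antidiagonal 3).over L) ψ hψ hJ) z hz,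
    fun z₁ hz₁ K hK => locally_bounded_twist Ec (D := Pᶜ) (fun z hz => hEbd z hz) (detChar (↥(maximalRealSubfield L)) L (IsCMField.complexConj L) h2 hc 3 ((StdForm.antidiagonal 3).over L) ψ hψ hJ) z₁ hz₁ K hK⟩
  funext x
  rw [hE2 z hz, eisensteinSeriesU_flatSectionU_mul_automorphicCharacter]

/-! ## §2 The rows `hEd hE4 hEbd` of ★ p863385 on `{1<Re} ∖ Sp` from the `Pᶜ`-rows and the pole ledger -/

omit [MeasurableSpace (quasiSplit (↥(maximalRealSubfield L)) L (IsCMField.complexConj L) 3).Adelic] [BorelSpace (quasiSplit (↥(maximalRealSubfield L)) L (IsCMField.complexConj L) 3).Adelic]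
  [MeasurableSpace (arch (↥(maximalRealSubfield L)) L (IsCMField.complexConj L) 3 ((StdForm.antidiagonal 3).over L))] [BorelSpace (arch (↥(maximalRealSubfield L)) L (IsCMField.complexConj L) 3 ((StdForm.antidiagonal 3).over L))]
  [MeasurableSpace (finAdelic (↥(maximalRealSubfield L)) L (IsCMField.complexConj L) 3 ((StdForm.antidiagonal 3).over L))] [BorelSpace (finAdelic (↥(maximalRealSubfield L)) L (IsCMField.complexConj L) 3 ((StdForm.antidiagonal 3).over L))] in
/-- **THE (V) ROAD'S ROWS `hEd hE4 hEbd` IN ★ p863385's BYTES** for any family `E` (apply to `E := Ec·Θ` of §1): holomorphy, (E4) and (E2-bd) OFF the pole set `P` give them on the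
slit half-plane `{1 < Re} ∖ Sp` as soon as the pole ledger places it off `P` (`{1<Re} ∖ Sp ⊆ Pᶜ`, K2E2-p12's ledger). [cite: MoeglinWaldspurger1995, IV.1.8–IV.1.11] -/
theorem chiPair_rowsEdE4Ebd_of_poleLedger {E : ℂ → (quasiSplit (↥(maximalRealSubfield L)) L (IsCMField.complexConj L) 3).Adelic → ℂ} {P : Set ℂ}
    (hEdiff : ∀ g, DifferentiableOn ℂ (fun z => E z g) Pᶜ) (hE4 : ∀ z : ℂ, z ∉ P → Continuous (E z))
    (hEbd : ∀ z₁ : ℂ, z₁ ∉ P → ∀ K : Set (quasiSplit (↥(maximalRealSubfield L)) L (IsCMField.complexConj L) 3).Adelic, IsCompact K → ∃ V ∈ 𝓝 z₁, ∃ M : ℝ, ∀ z ∈ V, ∀ g ∈ K, ‖E z g‖ ≤ M)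
    {Sp : Finset ℂ} (hSpP : ({z : ℂ | 1 < z.re} \ (↑Sp : Set ℂ)) ⊆ Pᶜ) :
    (∀ g, DifferentiableOn ℂ (fun z => E z g) ({z : ℂ | 1 < z.re} \ (↑Sp : Set ℂ))) ∧
      (∀ z ∈ ({z : ℂ | 1 < z.re} \ (↑Sp : Set ℂ)), Continuous (E z)) ∧
      (∀ z₁ ∈ ({z : ℂ | 1 < z.re} \ (↑Sp : Set ℂ)), ∀ K : Set (quasiSplit (↥(maximalRealSubfield L)) L (IsCMField.complexConj L) 3).Adelic, IsCompact K → ∃ V ∈ 𝓝 z₁, ∃ M : ℝ, ∀ z ∈ V, ∀ g ∈ K, ‖E z g‖ ≤ M) :=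
  ⟨fun g => (hEdiff g).mono hSpP, fun z hz => hE4 z (hSpP hz), fun z₁ hz₁ K hK => hEbd z₁ (hSpP hz₁) K hK⟩

end Summit.HodgeConjecture.HodgeConjecture.R90.S8

end
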